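import Literature.NumberTheory.EllipticCurves.VeluQuotientCurveProofs
import Literature.NumberTheory.EllipticCurves.VeluDiscriminantCoatesProofs
import Literature.NumberTheory.EllipticCurves.IsogenySeparableFactorProofs
import Literature.NumberTheory.EllipticCurves.IsogenyDegreeOneProofs
import HarnessLib

/-!
# Dokchitser–Dokchitser 2015, Thm. 3 for the tree's isogenies: `Δ(E)^{#ker φ} = u¹²·Δ(E')·Π(2y)⁴`
# for a `K`-isogeny `φ : E → E'` with odd kernel, and `Δ(E)ⁿ = Δ(E')·(u·g)¹²` for a cyclic
# kernel of order prime to `6` (proofs only)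

Topic `NumberTheory/EllipticCurves`; THEOREMS ONLY. The discriminant relation of
Dokchitser–Dokchitser (*Local invariants of isogenous elliptic curves*, Trans. AMS 367 (2015),
§2 Thm. 3 = Coates' lemma «`Δ(E)^p/Δ(E')` is a `12`-th power for a `p`-isogeny, `p > 3`», and the
discriminant row of their Table 1) for the tree's ABSTRACT isogenies
(`WeierstrassCurve.Isogeny`: `Γ_K`-equivariant algebraic homomorphisms on `K̄`-points), over a
number field `K`, source in short Weierstrass form:

* `Isogeny.exists_variableChange_quotCurve_eq` — **uniqueness of the quotient**: for a `K`-isogeny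
  `φ : E → E'` of elliptic curves, `E'` is `K`-isomorphic (an admissible change of variables over
  `K`) to the tree's quotient `E/ker φ` (`quotCurve`): the factorisation `φ = λ ∘ quot`
  (`exists_eq_comp_of_ker_le_of_surjective`) has `deg λ = 1`, and a degree-one isogeny over a
  number field is a change of variables (`exists_variableChange_eq_of_degree_eq_one`);
* **`Isogeny.exists_unit_Δ_pow_card_ker_eq`** — for `φ : E → E'` with kernel of odd order:
  `Δ(E)^{#ker φ} = u¹² · Δ(E') · Π_{v ∈ ker φ ∖ O} (2y(v))⁴` in `K̄` for a unit `u ∈ Kˣ`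
  (`VeluQuotientCurveProofs.algebraMap_Δ_quotCurve_mul_prod_pow_four`);
* **`Isogeny.exists_unit_Δ_pow_eq_mul_pow_twelve`** — for a CYCLIC kernel `⟨P⟩` of order
  `n = 2m + 1` prime to `3`: `Δ(E)ⁿ = Δ(E') · (u · Π_{k=1}^{m}(x(kP) - x(2kP)))¹²` in `K̄`, `u ∈ Kˣ`
  (`VeluDiscriminantCoatesProofs`). The product is a symmetric function of the kernel, hence lies
  in `K` when read through `Γ_K` (not proved here); over `K̄` the statement records the explicit
  `12`-th root.

## References
* [DokchitserDokchitser2015LocalInvariants] §2 Thm. 3 (Coates), Table 1.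
* [SilvermanAEC2009] Prop. III.4.12, Cor. III.4.11, II.2.4.1, Prop. III.3.1(b).
* [Velu1971] J. Vélu, C. R. Acad. Sci. Paris 273 (1971).
-/

noncomputable section

open scoped Classical

open Finset

universe u

namespace WeierstrassCurve

namespace Isogeny

open geomPoints Affine Affine.Point Literature.NumberTheory.EllipticCurves

variable {K : Type u} [Field K] {W W' : WeierstrassCurve K}

/-- The kernel of a `K`-isogeny is `Γ_K`-stable (`φ(σP) = σφ(P) = σO = O`); a private copy of
`Isogeny.smul_mem_ker` of `IsogenySelmerGroups` (not imported, to keep the import cone light).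
[folklore] -/
private theorem ker_smul_mem (φ : Isogeny W W') (σ : Field.absoluteGaloisGroup K) (P : W.geomPoints)
    (hP : P ∈ φ.toAddMonoidHom.ker) : σ • P ∈ φ.toAddMonoidHom.ker := by
  rw [AddMonoidHom.mem_ker, coe_toAddMonoidHom] at hP ⊢
  rw [φ.map_smul, hP, smul_zero]

variable [W.IsElliptic] [W'.IsElliptic]

/-- **Uniqueness of the quotient up to a change of variables over `K`** (number field `K`): for
a `K`-isogeny `φ : E → E'` of elliptic curves, there is an admissible change of variables `C` over
`K` with `C • (E/ker φ) = E'`, where `E/ker φ` is the tree's quotient curve `quotCurve`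
(Silverman III.4.12). Proof: `φ = λ ∘ quot` with `λ : E/ker φ → E'` a `K`-isogeny
(Cor. III.4.11, `exists_eq_comp_of_ker_le_of_surjective`); `ker λ = 0`, so `deg λ = 1` and `λ` is
a change of variables (II.2.4.1 with III.3.1(b), `exists_variableChange_eq_of_degree_eq_one`).
[cite: SilvermanAEC2009, Prop. III.4.12 (uniqueness of `E/Φ`) with Cor. III.4.11] -/
theorem exists_variableChange_quotCurve_eq [NumberField K] (φ : Isogeny W W')
    (hS : (φ.toAddMonoidHom.ker : Set W.geomPoints).Finite) :
    ∃ C : VariableChange K,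
      C • W.quotCurve φ.toAddMonoidHom.ker hS (fun σ P hP => ker_smul_mem φ σ P hP) = W' := by
  set S := φ.toAddMonoidHom.ker with hSdef
  have hstab : ∀ (σ : Field.absoluteGaloisGroup K) (P : W.geomPoints), P ∈ S → σ • P ∈ S :=
    fun σ P hP => ker_smul_mem φ σ P hP
  set q := W.quotIsogeny S hS hstab with hq
  have hdeg : q.deg ≤ Nat.card q.toAddMonoidHom.ker := by
    rw [hq, deg_quotIsogeny, ker_quotIsogeny]
  have hsurj : Function.Surjective q := quotFun_surjective hS hstab
  have hker : ∀ P : W.geomPoints, q P = 0 → φ P = 0 := fun P hP => by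
    have hPS : P ∈ S := (quotFun_eq_zero_iff hS hstab P).mp hP
    rwa [hSdef, AddMonoidHom.mem_ker, coe_toAddMonoidHom] at hPS
  obtain ⟨lam, hlam⟩ := q.exists_eq_comp_of_ker_le_of_surjective hdeg hsurj φ hker
  have hbot : lam.toAddMonoidHom.ker = ⊥ := by
    refine (AddSubgroup.eq_bot_iff_forall _).mpr fun Q hQ => ?_
    obtain ⟨P, rfl⟩ := hsurj Q
    rw [AddMonoidHom.mem_ker, coe_toAddMonoidHom, ← hlam P] at hQ
    have hPS : P ∈ S := by rw [hSdef, AddMonoidHom.mem_ker, coe_toAddMonoidHom]; exact hQ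
    exact (quotFun_eq_zero_iff hS hstab P).mpr hPS
  have hdeg1 : lam.degree = 1 := by
    rw [degree, hbot, AddSubgroup.card_bot]
  exact exists_variableChange_eq_of_degree_eq_one lam hdeg1

/-- **`Δ(E)^{#ker φ} = u¹² · Δ(E') · Π_{v ∈ ker φ ∖ O}(2y(v))⁴`** for a `K`-isogeny `φ : E → E'` of
elliptic curves over a number field, `E` in short Weierstrass form, whose kernel has no point of
order `2` (e.g. odd order); `u ∈ Kˣ` is the scaling of the `K`-isomorphism `E/ker φ ≅ E'`, the
identity read in `K̄`. Hence `Δ(E)^{#ker φ} ≡ Δ(E')·N⁴ (mod K^{×12})` with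
`N = Π_{v ≠ O} 2y(v)`: the discriminant relation of Dokchitser–Dokchitser's Thm. 3 / Table 1 for
every kernel of odd order. [cite: DokchitserDokchitser2015LocalInvariants, §2 Thm. 3 (Coates) with Table 1 (discriminants of isogenous curves)] -/
theorem exists_unit_Δ_pow_card_ker_eq [NumberField K] [W.IsShortNF] (φ : Isogeny W W')
    (hS : (φ.toAddMonoidHom.ker : Set W.geomPoints).Finite)
    (hodd : ∀ s ∈ φ.toAddMonoidHom.ker, -s = s → s = 0) :
    ∃ u : Kˣ, algebraMap K (AlgebraicClosure K) W.Δ ^ hS.toFinset.card =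
      algebraMap K (AlgebraicClosure K) ((u : K) ^ 12 * W'.Δ) *
        ∏ v ∈ @Finset.erase (W⁄(AlgebraicClosure K)).toAffine.Point _ hS.toFinset 0,
          (2 * yOf v) ^ 4 := by
  obtain ⟨C, hC⟩ := φ.exists_variableChange_quotCurve_eq hS
  refine ⟨C.u, ?_⟩
  have hb := algebraMap_Δ_quotCurve_mul_prod_pow_four (W := W) hS
    (fun σ P hP => ker_smul_mem φ σ P hP) hodd
  have hQ : W.quotCurve φ.toAddMonoidHom.ker hS (fun σ P hP => ker_smul_mem φ σ P hP) =
      C⁻¹ • W' := by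
    have e := congrArg (fun V => C⁻¹ • V) hC
    simp only [inv_smul_smul] at e
    exact e
  have hu : (C⁻¹).u⁻¹ = C.u := by show C.u⁻¹⁻¹ = C.u; exact inv_inv _
  rw [← hb, hQ, variableChange_Δ, hu]

/-- **Coates' lemma for the tree's isogenies (Dokchitser–Dokchitser 2015, Thm. 3, every cyclic
kernel of order prime to `6`).** Let `φ : E → E'` be a `K`-isogeny of elliptic curves over a
number field `K`, `E : y² = x³ + a₄x + a₆`, whose kernel is the cyclic group generated by a
point `P ∈ E(K̄)` of exact order `n = 2m + 1` with `3 ∤ n`. Then for some `u ∈ Kˣ`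
`Δ(E)ⁿ = Δ(E') · (u · Π_{k=1}^{m}(x(kP) - x(2kP)))¹²` in `K̄`: `Δ(E)ⁿ/Δ(E')` is the `12`-th
power of an explicit symmetric function of the kernel (printed for `n = p > 3` prime with an
analytic proof via `(η(pτ)^p/η(τ))²`; here from Vélu's formulae, Ward's symmetry of the division
values and the uniqueness of the quotient).
[cite: DokchitserDokchitser2015LocalInvariants, §2 Thm. 3 (Coates: `Δ^p/Δ'` is a 12th power)] -/
theorem exists_unit_Δ_pow_eq_mul_pow_twelve [NumberField K] [W.IsShortNF] (φ : Isogeny W W')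
    {x₀ y₀ : AlgebraicClosure K}
    (h : (W⁄(AlgebraicClosure K)).toAffine.Nonsingular x₀ y₀) {n m : ℕ} (hnm : n = 2 * m + 1)
    (h3 : Nat.Coprime 3 n) (h1n : 1 < n) (hn : (n : ℤ) • Point.some x₀ y₀ h = 0)
    (hmin : ∀ k : ℕ, 0 < k → k < n → (k : ℤ) • Point.some x₀ y₀ h ≠ 0)
    (hker : ∀ Q : W.geomPoints, Q ∈ φ.toAddMonoidHom.ker ↔
      Q ∈ (range n).image fun k : ℕ => (k : ℤ) • Point.some x₀ y₀ h) :
    ∃ u : Kˣ, algebraMap K (AlgebraicClosure K) W.Δ ^ n =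
      algebraMap K (AlgebraicClosure K) W'.Δ *
        (algebraMap K (AlgebraicClosure K) u *
          ∏ k ∈ Icc 1 m, (xOf ((k : ℤ) • Point.some x₀ y₀ h) -
            xOf ((2 * k : ℤ) • Point.some x₀ y₀ h))) ^ 12 := by
  have hGodd : IsOddSubgroupFinset ((range n).image fun k : ℕ => (k : ℤ) • Point.some x₀ y₀ h) :=
    isOddSubgroupFinset_zmultiples h hnm hn hmin
  have hS : (φ.toAddMonoidHom.ker : Set W.geomPoints).Finite :=
    (((range n).image fun k : ℕ => (k : ℤ) • Point.some x₀ y₀ h).finite_toSet).subset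
      fun Q hQ => (hker Q).mp hQ
  have hodd : ∀ s ∈ φ.toAddMonoidHom.ker, -s = s → s = 0 :=
    fun s hs hneg => hGodd.eq_zero_of_neg_eq s ((hker s).mp hs) hneg
  have hGS : hS.toFinset = (range n).image fun k : ℕ => (k : ℤ) • Point.some x₀ y₀ h := by
    ext Q
    rw [Set.Finite.mem_toFinset, SetLike.mem_coe]
    exact hker Q
  obtain ⟨C, hC⟩ := φ.exists_variableChange_quotCurve_eq hS
  refine ⟨C.u, ?_⟩
  have hbridge := algebraMap_Δ_quotCurve (W := W) hS (fun σ P hP => ker_smul_mem φ σ P hP) hodd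
  have hQ : W.quotCurve φ.toAddMonoidHom.ker hS (fun σ P hP => ker_smul_mem φ σ P hP) =
      C⁻¹ • W' := by
    have e := congrArg (fun V => C⁻¹ • V) hC
    simp only [inv_smul_smul] at e
    exact e
  have hu : (C⁻¹).u⁻¹ = C.u := by show C.u⁻¹⁻¹ = C.u; exact inv_inv _
  rw [hQ, variableChange_Δ, hu, hGS] at hbridge
  -- Coates' lemma in Vélu form, read on `W⁄K̄`
  have hcoates : (⟨0, 0, 0, veluA ((range n).image fun k : ℕ => (k : ℤ) • Point.some x₀ y₀ h),
        veluB ((range n).image fun k : ℕ => (k : ℤ) • Point.some x₀ y₀ h)⟩ :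
        WeierstrassCurve (AlgebraicClosure K)).Δ *
      (∏ k ∈ Icc 1 m, (xOf ((k : ℤ) • Point.some x₀ y₀ h) -
        xOf ((2 * k : ℤ) • Point.some x₀ y₀ h))) ^ 12 = (W⁄(AlgebraicClosure K)).Δ ^ n :=
    Affine.Point.veluDelta_mul_prod_sub_pow_twelve (W⁄(AlgebraicClosure K)) h hnm h3 h1n hn hmin
  rw [← hbridge, show (W⁄(AlgebraicClosure K)).Δ = algebraMap K (AlgebraicClosure K) W.Δ from
    W.map_Δ (algebraMap K (AlgebraicClosure K))] at hcoates
  rw [← hcoates, map_mul, map_pow]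
  ring

end Isogeny

end WeierstrassCurve
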